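import Summits.Ventures.Crystal3D.Theorems.StickyWulffConstantTextureLiminfTexShadowDefs
import HarnessLib

/-!
# TB-D: support function of the WALL BODY (the unit disc `⊥ m`) — upper bounds and the basal zero
# (lane T, crux `TextureLiminfV5`, stmt-Ventures-23912; design memo TB-D-0 §4 entries (B0)/(C)/(D), §5 S-bricks)

HONEST FRAMING. Venture `Summits/Ventures/Crystal3D` (cell `crystal3d-full`), route `route-Ventures-StickyWulffConstant`, helper `--supports` the
law-v5 crux `TextureLiminfV5` (stmt-Ventures-23912).  Elementary convex geometry (census-free, standard axioms); nothing about any texture or cover;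
F-C1 not moved.  The set is written out as `{y | ‖y‖ ≤ 1 ∧ ⟪y, m⟫ = 0}` (= `TexShadow.wallBody m` by `rfl`; spelled out to stay outside the Theses
import cone, as the P-lane's `sin_le_supportFn_cruxDisc` does).

* `supportFn_disc_le_norm` — `h_{D(m)}(ν) ≤ ‖ν‖` (any `m`);
* `supportFn_disc_le_sqrt` — for unit `m`: `h_{D(m)}(ν) ≤ √(‖ν‖² − ⟪ν, m⟫²)` (the component of `ν` in the disc's plane); with the P-lane's lower bound
  `sin_le_supportFn_cruxDisc` (…PolycrystalWulffBoundInclinedLamellarSections) this is the exact value `√(1 − ⟪ν,m⟫²)` for unit `ν` — the factor in the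
  co-axial wall charge `½·√(1 − ⟪m, ν⟫²)` that `Mesh.hlaw` / `BilayerChargeAdmissibleAt` put in the cell tables (TB-D-0 §4 (C));
* `supportFn_disc_self`, `supportFn_disc_neg_self` — `h_{D(m)}(±m) = 0`: the BASAL contact of two twin bilayer slab grains costs nothing (TB-D-0 §4 (B0)).
-/

noncomputable section

namespace Summit.Ventures.Crystal3D.Cruxes.TextureLiminf.TexShadow

open Summit.Ventures.Crystal3D
open scoped InnerProductSpace

/-- The disc `⊥ m` contains the origin. -/
theorem zero_mem_disc (m : E3) : (0 : E3) ∈ {y : E3 | ‖y‖ ≤ 1 ∧ ⟪y, m⟫_ℝ = 0} := by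
  simp

/-- The values `⟪y, ν⟫` over the disc are bounded above by `‖ν‖`. -/
theorem bddAbove_disc_inner (m ν : E3) : BddAbove ((fun y : E3 => ⟪y, ν⟫_ℝ) '' {y : E3 | ‖y‖ ≤ 1 ∧ ⟪y, m⟫_ℝ = 0}) := by
  refine ⟨‖ν‖, ?_⟩
  rintro _ ⟨y, hy, rfl⟩
  calc ⟪y, ν⟫_ℝ ≤ ‖y‖ * ‖ν‖ := real_inner_le_norm y ν
    _ ≤ 1 * ‖ν‖ := mul_le_mul_of_nonneg_right hy.1 (norm_nonneg ν)
    _ = ‖ν‖ := one_mul _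

/-- **`h_{D(m)}(ν) ≤ ‖ν‖`** (any `m`). -/
theorem supportFn_disc_le_norm (m ν : E3) : supportFn {y : E3 | ‖y‖ ≤ 1 ∧ ⟪y, m⟫_ℝ = 0} ν ≤ ‖ν‖ := by
  unfold supportFn
  refine csSup_le ⟨_, ⟨0, zero_mem_disc m, rfl⟩⟩ ?_
  rintro _ ⟨y, hy, rfl⟩
  calc ⟪y, ν⟫_ℝ ≤ ‖y‖ * ‖ν‖ := real_inner_le_norm y ν
    _ ≤ 1 * ‖ν‖ := mul_le_mul_of_nonneg_right hy.1 (norm_nonneg ν)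
    _ = ‖ν‖ := one_mul _

/-- For unit `m`: `‖ν − ⟪ν,m⟫ m‖² = ‖ν‖² − ⟪ν,m⟫²`. -/
theorem norm_sub_inner_smul_sq {m : E3} (hm : ‖m‖ = 1) (ν : E3) :
    ‖ν - ⟪ν, m⟫_ℝ • m‖ ^ 2 = ‖ν‖ ^ 2 - ⟪ν, m⟫_ℝ ^ 2 := by
  rw [norm_sub_sq_real, norm_smul, Real.norm_eq_abs, hm, mul_one, sq_abs, inner_smul_right, real_inner_comm m ν]
  ring

/-- **`h_{D(m)}(ν) ≤ √(‖ν‖² − ⟪ν,m⟫²)`** for unit `m`: a disc vector sees only the in-plane component of `ν`. -/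
theorem supportFn_disc_le_sqrt {m : E3} (hm : ‖m‖ = 1) (ν : E3) :
    supportFn {y : E3 | ‖y‖ ≤ 1 ∧ ⟪y, m⟫_ℝ = 0} ν ≤ Real.sqrt (‖ν‖ ^ 2 - ⟪ν, m⟫_ℝ ^ 2) := by
  unfold supportFn
  refine csSup_le ⟨_, ⟨0, zero_mem_disc m, rfl⟩⟩ ?_
  rintro _ ⟨y, hy, rfl⟩
  have hproj : ⟪y, ν⟫_ℝ = ⟪y, ν - ⟪ν, m⟫_ℝ • m⟫_ℝ := by
    rw [inner_sub_right, inner_smul_right, hy.2, mul_zero, sub_zero]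
  show ⟪y, ν⟫_ℝ ≤ _
  rw [hproj]
  calc ⟪y, ν - ⟪ν, m⟫_ℝ • m⟫_ℝ ≤ ‖y‖ * ‖ν - ⟪ν, m⟫_ℝ • m‖ := real_inner_le_norm _ _
    _ ≤ 1 * ‖ν - ⟪ν, m⟫_ℝ • m‖ := mul_le_mul_of_nonneg_right hy.1 (norm_nonneg _)
    _ = Real.sqrt (‖ν‖ ^ 2 - ⟪ν, m⟫_ℝ ^ 2) := by
        rw [one_mul, ← norm_sub_inner_smul_sq hm ν, Real.sqrt_sq (norm_nonneg _)]

/-- **`h_{D(m)}(m) = 0`**: the basal direction. -/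
theorem supportFn_disc_self (m : E3) : supportFn {y : E3 | ‖y‖ ≤ 1 ∧ ⟪y, m⟫_ℝ = 0} m = 0 := by
  unfold supportFn
  have himg : (fun y : E3 => ⟪y, m⟫_ℝ) '' {y : E3 | ‖y‖ ≤ 1 ∧ ⟪y, m⟫_ℝ = 0} = {0} := by
    ext t
    simp only [Set.mem_image, Set.mem_setOf_eq, Set.mem_singleton_iff]
    constructor
    · rintro ⟨y, ⟨-, hy⟩, rfl⟩; exact hy
    · rintro rfl; exact ⟨0, ⟨by simp, by simp⟩, by simp⟩
  rw [himg, csSup_singleton]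

/-- **`h_{D(m)}(−m) = 0`**. -/
theorem supportFn_disc_neg_self (m : E3) : supportFn {y : E3 | ‖y‖ ≤ 1 ∧ ⟪y, m⟫_ℝ = 0} (-m) = 0 := by
  unfold supportFn
  have himg : (fun y : E3 => ⟪y, -m⟫_ℝ) '' {y : E3 | ‖y‖ ≤ 1 ∧ ⟪y, m⟫_ℝ = 0} = {0} := by
    ext t
    simp only [Set.mem_image, Set.mem_setOf_eq, Set.mem_singleton_iff, inner_neg_right]
    constructor
    · rintro ⟨y, ⟨-, hy⟩, rfl⟩; rw [hy, neg_zero]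
    · rintro rfl; exact ⟨0, ⟨by simp, by simp⟩, by simp⟩
  rw [himg, csSup_singleton]

/-- For unit `ν` and unit `m` the bound reads `h_{D(m)}(ν) ≤ √(1 − ⟪ν,m⟫²)` — the geometric factor of the co-axial wall charge. -/
theorem supportFn_disc_le_sqrt_one_sub {m ν : E3} (hm : ‖m‖ = 1) (hν : ‖ν‖ = 1) :
    supportFn {y : E3 | ‖y‖ ≤ 1 ∧ ⟪y, m⟫_ℝ = 0} ν ≤ Real.sqrt (1 - ⟪ν, m⟫_ℝ ^ 2) := by
  have h := supportFn_disc_le_sqrt hm ν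
  rwa [hν, one_pow] at h

end Summit.Ventures.Crystal3D.Cruxes.TextureLiminf.TexShadow

end
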